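import Literature.Analysis.FluidPDE.FlatSwirlGauge
import Literature.Analysis.FluidPDE.DriftHeatLocalComparison

/-!
# The weak maximum principle for drift–diffusion laws with a degeneracy set (Evans, §7.1.4, Thm. 8, on a ball),
# and for the momentum of a flat swirl gauge under the Dirichlet clause

Literature/Analysis/FluidPDE proof file (theorems only, no definitions, no named facts), written by the line lead of crux
`CriticalSwirlRegularity` (stmt-NavierStokesRegularity-1253, route `FlatSwirlGauge`, continuation c3, 2026-08-17) as the
positive companion of `Summits/…/Theorems/CriticalSwirlRegularity/Negative/NoMaximumPrinciple.lean`, which shows that for the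
typed gauge block `IsFlatSwirlGaugeOn` (this directory, `FlatSwirlGauge.lean`) the weak parabolic maximum principle for the
momentum `α` FAILS (a momentum maximum sitting on the degeneracy set `{d ≤ 0}`, where no clause applies, can grow). Here: the
single extra clause `α ≤ K` on `{d ≤ 0}` (Dirichlet-type; in the exactly-flat model `Γ = r u_θ = 0` on the axis) restores
it, for ANY velocity `u` and ANY drift `b` (at an interior spatial maximum `∇α = 0` kills both `(u·∇)α` and `⟪b, ∇α⟫`):

* `weakMaximumPrinciple_of_dirichlet` (abstract, Evans 2010 §7.1.4 Thm. 8 on a ball, with a degeneracy set): if `α` is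
  continuous on `[t₁,t₂] × B̄_R(x₀)`, `C²` in space on a neighbourhood of the closed ball and differentiable in time wherever the
  law is asserted, satisfies `∂ₜα + (u·∇)α = ν(Δα + ⟪b, ∇α⟫)` (`ν > 0`) at the points of `(t₁,t₂] × B_R(x₀)` where `d > 0`,
  and `α ≤ K` where `d ≤ 0`, on the initial ball and on the lateral boundary, then `α ≤ K` on the whole closed cylinder.
  Proof: for `ε > 0` the continuous function `v = α − ε(t − t₁)` attains its maximum on the compact cylinder at some
  `(t*, x*)`; if `v(t*,x*) > K` then `t* > t₁`, `x*` is interior and `d(t*,x*) > 0`, so the law holds there, `∇α(t*,·)(x*) = 0`,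
  `Δα(t*,·)(x*) ≤ 0` (in-tree `laplacian_nonpos_of_isLocalMax_of_contDiffOn`), hence `∂ₜα(t*,x*) = νΔα ≤ 0`, while
  the one-sided Fermat condition in time gives `∂ₜα(t*,x*) ≥ ε` — contradiction; so `α ≤ K + ε(t₂ − t₁)` for every `ε`.
* `weakMaximumPrinciple_of_isFlatSwirlGaugeOn_of_dirichlet`: the statement NEGATED by c2's
  `weakMaximumPrinciple_false_of_isFlatSwirlGaugeOn`, verbatim, with the one extra hypothesis
  `∀ τ ∈ [t,s], ∀ y ∈ B_{ρ'}(x₀), d τ y ≤ 0 → α τ y ≤ K`, is TRUE.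

Use: together with the rest-state witnesses under `Summits/…/Theorems/CriticalSwirlRegularity/Negative/` this pins down what the
Dirichlet clause buys for the gauge block — the maximum principle (this file) but NOT a modulus of continuity
(`DirichletMomentumCollapse`) — and it is the first step ("maximum principle for `α`") of the route's `FlatGaugeExcludesTypeI`
sketch, made available for a restated block.

## References

* L. C. Evans, *Partial Differential Equations*, 2nd ed., AMS (2010), §7.1.4, Theorem 8 (weak maximum principle for
  parabolic operators, case `c = 0`) and its proof (penalisation `u − εt`). [Evans2010]
* D. Gilbarg, N. S. Trudinger, *Elliptic Partial Differential Equations of Second Order*, §3.1 (second-order conditions at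
  interior maxima). [GilbargTrudinger2001]
-/

noncomputable section

namespace Literature.Analysis.FluidPDE

open MeasureTheory Filter Set Metric Real InnerProductSpace Function Topology
open scoped RealInnerProductSpace Laplacian
open Literature.Analysis.FluidPDE

/-! ### One-sided Fermat in time -/

/-- **One-sided Fermat at a right end-point**: if `f ≤ f(t*)` on `[a, t*]` (`a < t*`) and `f` has derivative `D` within
`[a, t*]` at `t*`, then `0 ≤ D` (Fermat on the positive tangent cone, direction `a − t*`). [folklore] -/
theorem deriv_nonneg_of_forall_le_right {f : ℝ → ℝ} {D a tstar : ℝ} (hat : a < tstar)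
    (hf : HasDerivWithinAt f D (Icc a tstar) tstar) (hmax : ∀ s ∈ Icc a tstar, f s ≤ f tstar) : 0 ≤ D := by
  have hloc : IsLocalMaxOn f (Icc a tstar) tstar := IsMaxOn.localize fun s hs => hmax s hs
  have hy : (a - tstar : ℝ) ∈ posTangentConeAt (Icc a tstar) tstar := by
    refine mem_posTangentConeAt_of_segment_subset ?_
    rw [add_sub_cancel]
    exact (convex_Icc a tstar).segment_subset (right_mem_Icc.2 hat.le) (left_mem_Icc.2 hat.le)
  have h := hloc.hasFDerivWithinAt_nonpos hf.hasFDerivWithinAt hy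
  rw [ContinuousLinearMap.toSpanSingleton_apply, smul_eq_mul] at h
  nlinarith

/-! ### The weak maximum principle under the Dirichlet clause -/

/-- **Weak maximum principle for the flat transport law with a degeneracy set, under the Dirichlet clause** (Evans 2010,
§7.1.4, Thm. 8, on a ball). Let `ν > 0`, `t₁ ≤ t₂`, `0 < R`, `U` open with `B̄_R(x₀) ⊆ U`; `α` continuous on
`[t₁,t₂] × B̄_R(x₀)` with `α(t,·) ∈ C²(U)` for `t ∈ (t₁,t₂]`; at the points `(t,x) ∈ (t₁,t₂] × B_R(x₀)` with `d t x > 0` let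
`α(·,x)` be differentiable at `t` and `∂ₜα + (u·∇)α = ν(Δα + ⟪b, ∇α⟫)` hold; and let `α ≤ K` where `d ≤ 0` (Dirichlet-type
clause), on `{t₁} × B̄_R(x₀)` and on `[t₁,t₂] × ∂B_R(x₀)`. Then `α ≤ K` on `[t₁,t₂] × B̄_R(x₀)`. No assumption on `u`, `b`.
[cite: Evans2010, §7.1.4 Thm. 8] -/
theorem weakMaximumPrinciple_of_dirichlet
    {α : ℝ → EuclideanSpace ℝ (Fin 3) → ℝ} {u b : ℝ → EuclideanSpace ℝ (Fin 3) → EuclideanSpace ℝ (Fin 3)}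
    {d : ℝ → EuclideanSpace ℝ (Fin 3) → ℝ} {U : Set (EuclideanSpace ℝ (Fin 3))} {x₀ : EuclideanSpace ℝ (Fin 3)}
    {ν t₁ t₂ R K : ℝ} (hν : 0 < ν) (ht₁₂ : t₁ ≤ t₂) (hR : 0 < R) (hU : IsOpen U) (hRU : closedBall x₀ R ⊆ U)
    (hcont : ContinuousOn (uncurry α) (Icc t₁ t₂ ×ˢ closedBall x₀ R))
    (hC2 : ∀ t ∈ Ioc t₁ t₂, ContDiffOn ℝ 2 (α t) U)
    (hdt : ∀ t ∈ Ioc t₁ t₂, ∀ x ∈ ball x₀ R, 0 < d t x → DifferentiableAt ℝ (fun s => α s x) t)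
    (hlaw : ∀ t ∈ Ioc t₁ t₂, ∀ x ∈ ball x₀ R, 0 < d t x →
      deriv (fun s => α s x) t + convect (u t) (α t) x = ν * ((Δ (α t)) x + ⟪b t x, gradient (α t) x⟫))
    (hDir : ∀ t ∈ Ioc t₁ t₂, ∀ x ∈ ball x₀ R, d t x ≤ 0 → α t x ≤ K)
    (hinit : ∀ x ∈ closedBall x₀ R, α t₁ x ≤ K)
    (hlat : ∀ t ∈ Icc t₁ t₂, ∀ x ∈ sphere x₀ R, α t x ≤ K) :
    ∀ t ∈ Icc t₁ t₂, ∀ x ∈ closedBall x₀ R, α t x ≤ K := by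
  -- the penalised function `v = α − ε(t − t₁)` stays below `K` on the compact cylinder
  have key : ∀ ε : ℝ, 0 < ε → ∀ q ∈ Icc t₁ t₂ ×ˢ closedBall x₀ R, α q.1 q.2 - ε * (q.1 - t₁) ≤ K := by
    intro ε hε
    set v : ℝ × EuclideanSpace ℝ (Fin 3) → ℝ := fun q => α q.1 q.2 - ε * (q.1 - t₁) with hv_def
    have hKc : IsCompact (Icc t₁ t₂ ×ˢ closedBall x₀ R) := isCompact_Icc.prod (isCompact_closedBall x₀ R)
    have hne : (Icc t₁ t₂ ×ˢ closedBall x₀ R).Nonempty :=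
      ⟨(t₁, x₀), ⟨left_mem_Icc.2 ht₁₂, mem_closedBall_self hR.le⟩⟩
    have hvc : ContinuousOn v (Icc t₁ t₂ ×ˢ closedBall x₀ R) :=
      hcont.sub ((continuous_const.mul (continuous_fst.sub continuous_const)).continuousOn (s := _))
    obtain ⟨p, hp, hpmax⟩ := hKc.exists_isMaxOn hne hvc
    -- it suffices to bound the maximum value
    suffices hvp : v p ≤ K from fun q hq => (hpmax hq).trans hvp
    by_contra hgt
    push Not at hgt
    obtain ⟨hpt, hpx⟩ := mem_prod.1 hp
    have hε0 : 0 ≤ ε * (p.1 - t₁) := mul_nonneg hε.le (by linarith [hpt.1])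
    have hαp : K < α p.1 p.2 := by
      have : v p = α p.1 p.2 - ε * (p.1 - t₁) := rfl
      linarith
    -- `t* > t₁`
    have ht1 : t₁ < p.1 := by
      rcases eq_or_lt_of_le hpt.1 with h | h
      · exact absurd (hinit p.2 hpx) (by rw [h]; exact not_le.2 hαp)
      · exact h
    have hpIoc : p.1 ∈ Ioc t₁ t₂ := ⟨ht1, hpt.2⟩
    -- `x*` is interior
    have hxball : p.2 ∈ ball x₀ R := by
      rcases eq_or_lt_of_le (mem_closedBall.1 hpx) with h | h
      · exact absurd (hlat p.1 hpt p.2 (mem_sphere.2 h)) (not_le.2 hαp)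
      · exact mem_ball.2 h
    -- `d(t*, x*) > 0`
    have hdpos : 0 < d p.1 p.2 := by
      by_contra hd
      push Not at hd
      exact absurd (hDir p.1 hpIoc p.2 hxball hd) (not_le.2 hαp)
    -- spatial conditions at the interior maximum
    have hloc : IsLocalMax (α p.1) p.2 := by
      have hδ : 0 < R - dist p.2 x₀ := by linarith [mem_ball.1 hxball]
      filter_upwards [Metric.ball_mem_nhds p.2 hδ] with y hy
      have hyc : y ∈ closedBall x₀ R := by
        rw [mem_closedBall]
        have := dist_triangle y p.2 x₀
        linarith [mem_ball.1 hy]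
      have h : v (p.1, y) ≤ v p := (isMaxOn_iff.1 hpmax) _ ⟨hpt, hyc⟩
      change α p.1 y - ε * (p.1 - t₁) ≤ α p.1 p.2 - ε * (p.1 - t₁) at h
      linarith
    have hfd : fderiv ℝ (α p.1) p.2 = 0 := hloc.fderiv_eq_zero
    have hgrad : gradient (α p.1) p.2 = 0 := by
      rw [gradient, hfd, map_zero]
    have hconv : convect (u p.1) (α p.1) p.2 = 0 := by
      simp [convect_apply, hfd]
    have hlap : (Δ (α p.1)) p.2 ≤ 0 :=
      laplacian_nonpos_of_isLocalMax_of_contDiffOn hU (hRU (ball_subset_closedBall hxball)) (hC2 p.1 hpIoc) hloc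
    -- the law at `(t*, x*)`: `∂ₜα = νΔα ≤ 0`
    have hD : deriv (fun s => α s p.2) p.1 ≤ 0 := by
      have h := hlaw p.1 hpIoc p.2 hxball hdpos
      rw [hconv, hgrad, inner_zero_right, add_zero, add_zero] at h
      rw [h]
      exact mul_nonpos_of_nonneg_of_nonpos hν.le hlap
    -- one-sided Fermat in time: `∂ₜα ≥ ε`
    have hderiv : HasDerivAt (fun s => α s p.2 - ε * s) (deriv (fun s => α s p.2) p.1 - ε) p.1 :=
      ((hdt p.1 hpIoc p.2 hxball hdpos).hasDerivAt).sub (by simpa using (hasDerivAt_id p.1).const_mul ε)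
    have hmaxt : ∀ s ∈ Icc t₁ p.1, α s p.2 - ε * s ≤ α p.1 p.2 - ε * p.1 := by
      intro s hs
      have hsq : (s, p.2) ∈ Icc t₁ t₂ ×ˢ closedBall x₀ R := ⟨⟨hs.1, hs.2.trans hpt.2⟩, hpx⟩
      have h : v (s, p.2) ≤ v p := (isMaxOn_iff.1 hpmax) _ hsq
      change α s p.2 - ε * (s - t₁) ≤ α p.1 p.2 - ε * (p.1 - t₁) at h
      linarith
    have hpos := deriv_nonneg_of_forall_le_right ht1 hderiv.hasDerivWithinAt hmaxt
    linarith
  -- let `ε → 0`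
  intro t ht x hx
  by_contra hgt
  push Not at hgt
  set δ : ℝ := α t x - K with hδ
  have hδ0 : 0 < δ := by linarith
  have hL : 0 < t₂ - t₁ + 1 := by linarith
  have h := key (δ / (2 * (t₂ - t₁ + 1))) (by positivity) (t, x) ⟨ht, hx⟩
  simp only at h
  have hbound : δ / (2 * (t₂ - t₁ + 1)) * (t - t₁) ≤ δ / 2 := by
    rw [div_mul_eq_mul_div, div_le_div_iff₀ (by positivity) two_pos]
    have : t - t₁ ≤ t₂ - t₁ + 1 := by linarith [ht.2]
    nlinarith
  linarith

/-- **The Dirichlet clause restores the weak maximum principle for typed flat swirl gauges.** The statement negated by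
`Negative.weakMaximumPrinciple_false_of_isFlatSwirlGaugeOn` — for `IsFlatSwirlGaugeOn ν u T x₀ ρ C₀ M α b d`, `ν > 0`, a
sub-cylinder `[t,s] × B̄_{ρ'}(x₀)` (`T − ρ² < t ≤ s < T`, `0 < ρ' < ρ`) and a constant `K` dominating `α(t,·)` on `B̄_{ρ'}(x₀)`
and `α` on `[t,s] × ∂B_{ρ'}(x₀)`, conclude `α(s,·) ≤ K` on `B̄_{ρ'}(x₀)` — becomes TRUE under the single extra hypothesis
`α ≤ K` on `{d ≤ 0} ∩ ([t,s] × B_{ρ'}(x₀))` (the Dirichlet-type clause; in the exactly-flat model `Γ = 0` on the axis).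
[cite: Evans2010, §7.1.4 Thm. 8] -/
theorem weakMaximumPrinciple_of_isFlatSwirlGaugeOn_of_dirichlet {ν T ρ C₀ M : ℝ}
    {u : ℝ → EuclideanSpace ℝ (Fin 3) → EuclideanSpace ℝ (Fin 3)} {x₀ : EuclideanSpace ℝ (Fin 3)}
    {α : ℝ → EuclideanSpace ℝ (Fin 3) → ℝ} {b : ℝ → EuclideanSpace ℝ (Fin 3) → EuclideanSpace ℝ (Fin 3)}
    {d : ℝ → EuclideanSpace ℝ (Fin 3) → ℝ} (h : IsFlatSwirlGaugeOn ν u T x₀ ρ C₀ M α b d) (hν : 0 < ν)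
    {t s ρ' K : ℝ} (ht : T - ρ ^ 2 < t) (hts : t ≤ s) (hs : s < T) (hρ' : 0 < ρ') (hρ'ρ : ρ' < ρ)
    (hDir : ∀ τ ∈ Icc t s, ∀ y ∈ ball x₀ ρ', d τ y ≤ 0 → α τ y ≤ K)
    (hinit : ∀ y ∈ closedBall x₀ ρ', α t y ≤ K)
    (hlat : ∀ τ ∈ Icc t s, ∀ y ∈ sphere x₀ ρ', α τ y ≤ K) :
    ∀ x ∈ closedBall x₀ ρ', α s x ≤ K := by
  obtain ⟨-, -, hcd, -, -⟩ := id h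
  have hI : Icc t s ⊆ Ioo (T - ρ ^ 2) T := fun τ hτ => ⟨ht.trans_le hτ.1, hτ.2.trans_lt hs⟩
  have hB : closedBall x₀ ρ' ⊆ ball x₀ ρ := closedBall_subset_ball hρ'ρ
  -- spatial `C²` slices and time differentiability from the joint `C²` regularity
  have hC2 : ∀ τ ∈ Ioc t s, ContDiffOn ℝ 2 (α τ) (ball x₀ ρ) := fun τ hτ => by
    have hτ' : τ ∈ Ioo (T - ρ ^ 2) T := hI ⟨hτ.1.le, hτ.2⟩
    have hmap : MapsTo (fun y : EuclideanSpace ℝ (Fin 3) => (τ, y)) (ball x₀ ρ) (Ioo (T - ρ ^ 2) T ×ˢ ball x₀ ρ) :=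
      fun y hy => ⟨hτ', hy⟩
    exact hcd.comp (contDiff_prodMk_right τ).contDiffOn hmap
  have hdt : ∀ τ ∈ Ioc t s, ∀ x ∈ ball x₀ ρ', 0 < d τ x → DifferentiableAt ℝ (fun σ => α σ x) τ := by
    intro τ hτ x hx _
    have hτ' : τ ∈ Ioo (T - ρ ^ 2) T := hI ⟨hτ.1.le, hτ.2⟩
    have hmap : MapsTo (fun σ : ℝ => (σ, x)) (Ioo (T - ρ ^ 2) T) (Ioo (T - ρ ^ 2) T ×ˢ ball x₀ ρ) :=
      fun σ hσ => ⟨hσ, hB (ball_subset_closedBall hx)⟩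
    have hc : ContDiffOn ℝ 2 (fun σ : ℝ => α σ x) (Ioo (T - ρ ^ 2) T) :=
      hcd.comp (contDiff_prodMk_left x).contDiffOn hmap
    exact (hc.differentiableOn (by norm_num)).differentiableAt (Ioo_mem_nhds hτ'.1 hτ'.2)
  have hcont : ContinuousOn (uncurry α) (Icc t s ×ˢ closedBall x₀ ρ') :=
    hcd.continuousOn.mono (prod_mono hI hB)
  have hlaw : ∀ τ ∈ Ioc t s, ∀ x ∈ ball x₀ ρ', 0 < d τ x →
      deriv (fun σ => α σ x) τ + convect (u τ) (α τ) x = ν * ((Δ (α τ)) x + ⟪b τ x, gradient (α τ) x⟫) :=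
    fun τ hτ x hx hd => h.transport (hI ⟨hτ.1.le, hτ.2⟩) (hB (ball_subset_closedBall hx)) hd
  have hDir' : ∀ τ ∈ Ioc t s, ∀ y ∈ ball x₀ ρ', d τ y ≤ 0 → α τ y ≤ K :=
    fun τ hτ y hy hd => hDir τ ⟨hτ.1.le, hτ.2⟩ y hy hd
  exact weakMaximumPrinciple_of_dirichlet (u := u) (b := b) hν hts hρ' isOpen_ball hB hcont hC2 hdt hlaw hDir'
    hinit hlat s (right_mem_Icc.2 hts)

end Literature.Analysis.FluidPDE
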